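import Literature.RepresentationTheory.FiniteGroups.GL2ModularPrincipalSeriesLatticeUnique
import Mathlib.NumberTheory.Padics.RingHoms
import Mathlib.LinearAlgebra.FreeModule.PID
import HarnessLib

/-!
# The lattice theorem for the tame principal-series type over a principal ideal domain (`ℤ_p`)

Topic `Literature/RepresentationTheory/FiniteGroups`, namespace `Literature.RepresentationTheory.FiniteGroups.GL2`.
THEOREMS ONLY; no named fact, no instance, no notation, no `sorry`.  Sequel of
`GL2ModularPrincipalSeriesLatticeUnique` ([EmertonGeeSavitt2015, Lemma 4.1.1] applied to `Ind(χ₁ ⊗ χ₂)` of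
`GL₂(𝔽_p)`): the hypotheses `Finite (Λ/ϖΛ)` and `#(Λ/ϖΛ) ≤ #k^(p+1)` of `exists_eq_pow_smul_top(_of_symPow)` are
discharged when the coefficient ring is a PID with finite residue field, and the remaining ring-theoretic hypotheses
are discharged for `R = ℤ_p`, `ϖ = p`.

* over a PRINCIPAL IDEAL DOMAIN `R` with finite residue field (e.g. `ℤ_p`): `nonempty_linearEquiv_of_pow_smul_top_le`
  (a stable lattice of finite index is free of rank `p + 1`), `natCard_quot_eq_of_pow_smul_top_le` /
  `finite_quot_of_pow_smul_top_le` (`#(Λ/ϖΛ) = #k^(p+1)`), hence **`exists_eq_pow_smul_top_of_pid`** — the lattice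
  theorem WITHOUT cardinality/finiteness hypotheses;
* `padicInt_mul_eq_zero`, `padicInt_eq_zero_of_forall_pow_dvd`, `padicInt_algebraMap_eq_zero_iff`,
  `padicInt_ker_eq_maximalIdeal` — the four hypotheses on `(R, ϖ, R → k)` discharged for `R = ℤ_p`, `ϖ = p` and
  any algebra `ℤ_p ↠ k` onto a field.


-/

noncomputable section

namespace Literature.RepresentationTheory.FiniteGroups

namespace GL2

open Function Pointwise
open Literature.NumberTheory.Automorphic (TwistedQuotient.resScalars TwistedQuotient.resScalars_apply)

section FreeLattice

/-! ### Over a principal ideal domain the cardinality hypothesis is automatic -/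

variable (p : ℕ) [Fact p.Prime] {R : Type} [CommRing R] [IsDomain R] [IsPrincipalIdealRing R] {k : Type} [Field k]
  [CharP k p] [Algebra R k] (χ₁ χ₂ : (ZMod p)ˣ →* Rˣ) {V₀ : Type} [AddCommGroup V₀] [Module R V₀]
  {ρ₀ : Representation R (GL (Fin 2) (ZMod p)) V₀} (e₀ : ρ₀.Equiv (principalSeriesRep (ZMod p) χ₁ χ₂)) {r s : ℕ}

omit [IsDomain R] [IsPrincipalIdealRing R] in
/-- The reduction submodule `(ϖ • Λ) ∩ Λ ⊆ Λ`, regarded over `R`, is `ϖ • Λ`. [cite: EmertonGeeSavitt2015, Lemma 4.1.1] -/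
theorem restrictScalars_comap_pointwise_smul (ϖ : R)
    (Λ : Submodule (MonoidAlgebra R (GL (Fin 2) (ZMod p))) ρ₀.asModule) :
    ((ϖ • Λ).comap Λ.subtype).restrictScalars R = ϖ • (⊤ : Submodule R ↥Λ) := by
  ext x
  rw [Submodule.restrictScalars_mem, Submodule.mem_comap, ← SetLike.mem_coe, Submodule.coe_pointwise_smul,
    Set.mem_smul_set, ← SetLike.mem_coe, Submodule.coe_pointwise_smul, Set.mem_smul_set]
  constructor
  · rintro ⟨y, hy, hyx⟩
    exact ⟨⟨y, hy⟩, Submodule.mem_top, Subtype.ext hyx⟩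
  · rintro ⟨y, -, rfl⟩
    exact ⟨y, y.2, rfl⟩

include e₀ in
/-- **Over a PID a stable lattice of finite index is free of rank `p + 1`**: an `R`-linear isomorphism
`Λ ≃ ρ₀` (`ϖ ≠ 0`, `ϖᵐ ρ₀ ⊆ Λ`). [cite: EmertonGeeSavitt2015, Lemma 4.1.1] -/
theorem nonempty_linearEquiv_of_pow_smul_top_le {ϖ : R} (hϖ : ϖ ≠ 0)
    (Λ : Submodule (MonoidAlgebra R (GL (Fin 2) (ZMod p))) ρ₀.asModule) {m : ℕ}
    (hm : ϖ ^ m • (⊤ : Submodule (MonoidAlgebra R (GL (Fin 2) (ZMod p))) ρ₀.asModule) ≤ Λ) :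
    Nonempty (↥Λ ≃ₗ[R] ρ₀.asModule) := by
  classical
  have hreg : ∀ a : R, ϖ * a = 0 → a = 0 := fun a ha => (mul_eq_zero.mp ha).resolve_left hϖ
  -- `ρ₀` is free of rank `p + 1`
  let b : Module.Basis (Option (ZMod p)) R ρ₀.asModule :=
    (Pi.basisFun R (Option (ZMod p))).map (modelCoord p χ₁ χ₂ e₀).symm
  haveI : Module.Free R ρ₀.asModule := Module.Free.of_basis b
  haveI : Module.Finite R ρ₀.asModule := Module.Finite.of_basis b
  have hrk : Module.finrank R ρ₀.asModule = p + 1 := by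
    rw [Module.finrank_eq_card_basis b, Fintype.card_option, ZMod.card]
  -- `Λ` (over `R`) is free of finite rank `n ≤ p + 1`
  obtain ⟨n, bΛ⟩ := Submodule.basisOfPid b (Λ.restrictScalars R)
  let ι : ↥Λ ≃ₗ[R] ↥(Λ.restrictScalars R) :=
    { toFun := fun x => ⟨x.1, x.2⟩, invFun := fun x => ⟨x.1, x.2⟩, map_add' := fun _ _ => rfl,
      map_smul' := fun _ _ => rfl, left_inv := fun _ => rfl, right_inv := fun _ => rfl }
  let bΛ' : Module.Basis (Fin n) R ↥Λ := bΛ.map ι.symm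
  haveI : Module.Free R ↥Λ := Module.Free.of_basis bΛ'
  haveI : Module.Finite R ↥Λ := Module.Finite.of_basis bΛ'
  have hn : Module.finrank R ↥Λ = n := by rw [Module.finrank_eq_card_basis bΛ', Fintype.card_fin]
  have hle : n ≤ p + 1 := by
    have := Module.Basis.card_le_card_of_submodule (Λ.restrictScalars R) b bΛ
    rwa [Fintype.card_fin, Fintype.card_option, ZMod.card] at this
  -- and `≥ p + 1`, since `v ↦ ϖᵐ v` embeds `ρ₀` into `Λ`
  let g : ρ₀.asModule →ₗ[R] ↥Λ :=
    { toFun := fun v => ⟨ϖ ^ m • v, hm (Submodule.smul_mem_pointwise_smul v _ ⊤ Submodule.mem_top)⟩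
      map_add' := fun v w => Subtype.ext (smul_add _ _ _)
      map_smul' := fun c v => Subtype.ext (smul_comm _ _ _) }
  have hg : Injective g := by
    intro v w hvw
    have h := congrArg Subtype.val hvw
    have : v - w = 0 := eq_zero_of_pow_smul_eq_zero p χ₁ χ₂ e₀ hreg m _ (by
      rw [smul_sub, sub_eq_zero]; exact h)
    exact sub_eq_zero.mp this
  have hge : p + 1 ≤ n := by
    have := LinearMap.finrank_le_finrank_of_injective hg
    rwa [hrk, hn] at this
  have hfin : Module.finrank R ↥Λ = Module.finrank R ρ₀.asModule := by rw [hn, hrk]; omega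
  exact FiniteDimensional.nonempty_linearEquiv_of_finrank_eq hfin

omit [CharP k p] in
include e₀ in
/-- **Over a PID the reduction of a stable lattice of finite index has `#k^(p+1)` elements** and is finite
(`ϖ ≠ 0`, `ker (R → k) = (ϖ)`, `R → k` onto, `ϖᵐ ρ₀ ⊆ Λ`). [cite: EmertonGeeSavitt2015, Lemma 4.1.1] -/
theorem natCard_quot_eq_of_pow_smul_top_le {ϖ : R} (hϖ : ϖ ≠ 0)
    (hker : ∀ a : R, algebraMap R k a = 0 ↔ ϖ ∣ a) (hsurj : Surjective (algebraMap R k))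
    (Λ : Submodule (MonoidAlgebra R (GL (Fin 2) (ZMod p))) ρ₀.asModule) {m : ℕ}
    (hm : ϖ ^ m • (⊤ : Submodule (MonoidAlgebra R (GL (Fin 2) (ZMod p))) ρ₀.asModule) ≤ Λ) :
    Nat.card (↥Λ ⧸ (ϖ • Λ).comap Λ.subtype) = Nat.card k ^ (p + 1) := by
  obtain ⟨f⟩ := nonempty_linearEquiv_of_pow_smul_top_le p χ₁ χ₂ e₀ hϖ Λ hm
  obtain ⟨f₀⟩ := nonempty_linearEquiv_of_pow_smul_top_le p χ₁ χ₂ e₀ hϖ ⊤ (m := 0) le_top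
  -- `Λ/ϖΛ ≃ ρ₀/ϖρ₀ ≃ ⊤/ϖ⊤` as `R`-modules
  have key : ∀ (L : Submodule (MonoidAlgebra R (GL (Fin 2) (ZMod p))) ρ₀.asModule) (e : ↥L ≃ₗ[R] ρ₀.asModule),
      Nat.card (↥L ⧸ (ϖ • L).comap L.subtype) =
        Nat.card (ρ₀.asModule ⧸ (ϖ • (⊤ : Submodule R ρ₀.asModule))) := by
    intro L e
    rw [← Nat.card_congr (Submodule.Quotient.restrictScalarsEquiv R ((ϖ • L).comap L.subtype)).toEquiv,
      restrictScalars_comap_pointwise_smul p ϖ L]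
    refine Nat.card_congr (Submodule.Quotient.equiv (ϖ • ⊤) (ϖ • ⊤) e ?_).toEquiv
    rw [Submodule.map_pointwise_smul, Submodule.map_top, LinearEquiv.range]
  rw [key Λ f, ← key ⊤ f₀]
  exact natCard_modelQuot p χ₁ χ₂ e₀ hker hsurj

omit [CharP k p] in
include e₀ in
/-- Finiteness of the reduction over a PID with finite residue field. [cite: EmertonGeeSavitt2015, Lemma 4.1.1] -/
theorem finite_quot_of_pow_smul_top_le [Finite k] {ϖ : R} (hϖ : ϖ ≠ 0)
    (hker : ∀ a : R, algebraMap R k a = 0 ↔ ϖ ∣ a) (hsurj : Surjective (algebraMap R k))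
    (Λ : Submodule (MonoidAlgebra R (GL (Fin 2) (ZMod p))) ρ₀.asModule) {m : ℕ}
    (hm : ϖ ^ m • (⊤ : Submodule (MonoidAlgebra R (GL (Fin 2) (ZMod p))) ρ₀.asModule) ≤ Λ) :
    Finite (↥Λ ⧸ (ϖ • Λ).comap Λ.subtype) := by
  haveI : Nontrivial R := (algebraMap R k).domain_nontrivial
  apply Nat.finite_of_card_ne_zero
  rw [natCard_quot_eq_of_pow_smul_top_le p χ₁ χ₂ e₀ hϖ hker hsurj Λ hm]
  exact pow_ne_zero _ (Nat.card_pos.ne')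

/-- **EGS Lemma 4.1.1 for the tame principal-series type over a PID** (e.g. `R = ℤ_p`, `k = 𝔽_p`, `ϖ = p`): with
`R` a principal ideal domain, `k` finite and `⋂ ϖʲR = 0`, every `GL₂(𝔽_p)`-stable lattice `Λ` of finite index in
a model `ρ₀ ≃ Fun_R(Ind(χ₁ ⊗ χ₂))` whose reduction `Λ/ϖΛ` has socle `⊆ {Sym^r ⊗ χ̄₁∘det}` (every nonzero
`R[GL₂(𝔽_p)]`-submodule receives `Sym^r(k²) ⊗ (χ̄₁∘det)` injectively) is `ϖᶜ ρ₀` — no cardinality or finiteness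
hypothesis. [cite: EmertonGeeSavitt2015, Lemma 4.1.1] -/
theorem exists_eq_pow_smul_top_of_pid (e₀ : ρ₀.Equiv (principalSeriesRep (ZMod p) χ₁ χ₂)) [Finite k] {ϖ : R} (hϖ : ϖ ≠ 0)
    (hsepR : ∀ a : R, (∀ j : ℕ, ϖ ^ j ∣ a) → a = 0)
    (hker : ∀ a : R, algebraMap R k a = 0 ↔ ϖ ∣ a) (hsurj : Surjective (algebraMap R k))
    (hχne : reduceChar k χ₁ ≠ reduceChar k χ₂)
    (hχ : ∀ a : (ZMod p)ˣ, (reduceChar k χ₂ a : k) = (reduceChar k χ₁ a : k) * ZMod.castHom (dvd_refl p) k a ^ r)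
    (hrs : r + s = p - 1)
    (Λ : Submodule (MonoidAlgebra R (GL (Fin 2) (ZMod p))) ρ₀.asModule) {m : ℕ}
    (hm : ϖ ^ m • (⊤ : Submodule (MonoidAlgebra R (GL (Fin 2) (ZMod p))) ρ₀.asModule) ≤ Λ)
    (hsoc : ∀ N : Submodule (MonoidAlgebra R (GL (Fin 2) (ZMod p))) (↥Λ ⧸ (ϖ • Λ).comap Λ.subtype), N ≠ ⊥ →
      ∃ f : (TwistedQuotient.resScalars R
          (symPowTwist (ZMod.castHom (dvd_refl p) k) (reduceChar k χ₁) r)).asModule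
            →ₗ[MonoidAlgebra R (GL (Fin 2) (ZMod p))] ↥N, Injective f) :
    ∃ c : ℕ, Λ = ϖ ^ c • (⊤ : Submodule (MonoidAlgebra R (GL (Fin 2) (ZMod p))) ρ₀.asModule) := by
  haveI := finite_quot_of_pow_smul_top_le p χ₁ χ₂ e₀ hϖ hker hsurj Λ hm
  exact exists_eq_pow_smul_top_of_symPow p χ₁ χ₂ e₀ (fun a ha => (mul_eq_zero.mp ha).resolve_left hϖ) hsepR
    hker hsurj hχne hχ hrs Λ hm (natCard_quot_eq_of_pow_smul_top_le p χ₁ χ₂ e₀ hϖ hker hsurj Λ hm).le hsoc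

end FreeLattice

section PadicIntegers

/-! ### The hypotheses on the coefficient ring for `R = ℤ_p`, `ϖ = p` -/

variable (p : ℕ) [Fact p.Prime]

/-- `p` is a non-zero-divisor of `ℤ_p`. [cite: EmertonGeeSavitt2015, Lemma 4.1.1] -/
theorem padicInt_mul_eq_zero (a : ℤ_[p]) (h : (p : ℤ_[p]) * a = 0) : a = 0 :=
  (mul_eq_zero.mp h).resolve_left (NeZero.ne _)

/-- `⋂ⱼ pʲ ℤ_p = 0`: an element of `ℤ_p` divisible by every power of `p` is `0`. [cite: EmertonGeeSavitt2015, Lemma 4.1.1] -/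
theorem padicInt_eq_zero_of_forall_pow_dvd (a : ℤ_[p]) (h : ∀ j : ℕ, (p : ℤ_[p]) ^ j ∣ a) : a = 0 := by
  by_contra ha
  have hpos : 0 < ‖a‖ := norm_pos_iff.mpr ha
  -- `‖a‖ ≤ p^{-j}` for every `j`
  have hle : ∀ j : ℕ, ‖a‖ ≤ (p : ℝ) ^ (-j : ℤ) := fun j =>
    (PadicInt.norm_le_pow_iff_mem_span_pow a j).mpr (Ideal.mem_span_singleton.mpr (h j))
  have hp1 : (1 : ℝ) < p := by exact_mod_cast (Fact.out : p.Prime).one_lt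
  obtain ⟨j, hj⟩ := exists_pow_lt_of_lt_one hpos (inv_lt_one_of_one_lt₀ hp1)
  have := hle j
  rw [zpow_neg, zpow_natCast, ← inv_pow] at this
  exact absurd (lt_of_le_of_lt this hj) (lt_irrefl _)

/-- For an algebra `ℤ_p → k` whose kernel is the maximal ideal (e.g. any surjection onto a field, such as
`ℤ_p → 𝔽_p`): `a ↦ 0 ↔ p ∣ a`. [cite: EmertonGeeSavitt2015, Lemma 4.1.1] -/
theorem padicInt_algebraMap_eq_zero_iff {k : Type*} [CommRing k] [Algebra ℤ_[p] k]
    (hker : RingHom.ker (algebraMap ℤ_[p] k) = IsLocalRing.maximalIdeal ℤ_[p]) (a : ℤ_[p]) :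
    algebraMap ℤ_[p] k a = 0 ↔ (p : ℤ_[p]) ∣ a := by
  rw [← RingHom.mem_ker, hker, PadicInt.maximalIdeal_eq_span_p, Ideal.mem_span_singleton]

/-- A ring homomorphism from the local ring `ℤ_p` onto a field has kernel the maximal ideal. [cite: EmertonGeeSavitt2015, Lemma 4.1.1] -/
theorem padicInt_ker_eq_maximalIdeal {k : Type*} [Field k] [Algebra ℤ_[p] k]
    (hsurj : Surjective (algebraMap ℤ_[p] k)) :
    RingHom.ker (algebraMap ℤ_[p] k) = IsLocalRing.maximalIdeal ℤ_[p] :=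
  (RingHom.ker_isMaximal_of_surjective (algebraMap ℤ_[p] k) hsurj).eq_of_le
    (IsLocalRing.maximalIdeal.isMaximal ℤ_[p]).ne_top
    (IsLocalRing.le_maximalIdeal (RingHom.ker_ne_top (algebraMap ℤ_[p] k)))

end PadicIntegers

end GL2

end Literature.RepresentationTheory.FiniteGroups
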